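import Literature.NumberTheory.EllipticCurves.Kato2004.IwasawaCohomologyNumberFieldTwistModel
import HarnessLib

/-!
# The TWISTED Shapiro maps: `res^A : 𝐇¹_Γ(T_pA) → 𝐇¹_{K,Γ}(T_pW_K)` and `cor^A : 𝐇¹_{K,Γ}(T_pW_K) → 𝐇¹_Γ(T_pA)` for a curve `A/ℚ`
# with `T_pA ≅ T_pW` as `Gal(ℚ̄/K)`-modules (the quadratic twist `A = W^K`), built through the subgroup model `V_n`

Topic `NumberTheory/EllipticCurves`, sub-directory `Kato2004`; seventh file of the `K`-carrier vocabulary.  Seat `bsd-2adic-conv-1`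
GEN 30 (cell `pub/bsd-2adic`).  HONEST FRAMING: definitions with bodies and proved theorems only; no named fact, no `sorry`; nothing
about any curve is asserted; BSD is not advanced by this file.

Data: `u : T_pA ≃ T_pW` continuous both ways, equivariant for `galRange K` (`hu`, `hu'`, `hu₁`; supplied for the quadratic twist by
`WeierstrassCurve.exists_tateModule_equiv_of_smul_eq_quadraticTwist`).  With `M_n = layerToGalRange`, `N_n = layerOfGalRange` (the model iso
`H¹(K_n, T_pW_K) ≅ H¹(V_n, T_pW)`) and `u_* = layerTwist`, `u⁻¹_* = layerUntwist` (file `…TwistModel`):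

* §1 **`layerResTwist n = N_n ∘ u_* ∘ res_{V_n/U_n} : H¹(ℚ_n, T_pA) → H¹(K_n, T_pW_K)`** and
  **`layerCorTwist n = cor_{U_n/V_n} ∘ u⁻¹_* ∘ M_n : H¹(K_n, T_pW_K) → H¹(ℚ_n, T_pA)`**; integral ↦ integral
  (`layerResTwist_mem_integralH1K`, `layerCorTwist_mem_integralH1` — the latter by the general Mackey lemma), compatible with the trace
  maps (`layerResTwist_layerCores`, `layerCorTwist_layerCoresOver`), equivariant (`…_conjMap`, for `K/ℚ` Galois).
* §2 on the pinned carriers: **`IwasawaH1Data.resOverTwist I_A IK … : I_A.H →ₗ[Λ] IK.H`** and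
  **`IwasawaH1DataOver.corOverTwist IK I_A … : IK.H →ₗ[Λ] I_A.H`** (`proj_resOverTwist`, `proj_corOverTwist`, uniqueness), `Λ`-linear.

For `A = W`, `u = id` these are `resOver` / `corOver` of `…Restriction.lean` / `…Corestriction.lean` (up to the model identification
`layerResOver_eq_layerOfGalRange_resLe`, `layerCorOver_apply`).  The sum identity `res∘cor + res^A∘cor^A = 2` is the next file.

References: J. Neukirch, A. Schmidt, K. Wingberg, *Cohomology of Number Fields* (2008), I §5 Prop. 1.5.4, (1.5.6)–(1.5.7)
[NeukirchSchmidtWingberg2008]; K. Kato, Astérisque 295 (2004) §8.2, §12.2 [Kato2004Asterisque]; K. Rubin, *Euler Systems* (2000) App. B §3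
[Rubin2000]; J. H. Silverman, *AEC* (2009) X.5 Cor. 5.4 [SilvermanAEC2009].
-/

noncomputable section

open scoped NumberField Pointwise
open CategoryTheory Field IsDedekindDomain Polynomial
open Literature.NumberTheory.GaloisRepresentations
open Literature.NumberTheory.EllipticCurves (subgroupInclusion subgroupInclusion_apply_coe
  subgroupConj subgroupConj_apply_coe tateModuleEquiv galRange rangeToResGal resGal)
open Literature.NumberTheory.EllipticCurves.Kato2004.CM (tateRepK integralH1K mem_integralH1K_iff)
open Literature.NumberTheory.EllipticCurves.Kato2004.EulerSystemValues (tateRep)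

namespace Literature.NumberTheory.EllipticCurves.Kato2004

/-! ## §1 The twisted maps at the `n`-th layer -/

section Layer

variable (K : Type) [Field K] [NumberField K] {p : ℕ} [Fact p.Prime] (κ : ZpExtension ℚ p)
  (h : Function.Surjective (κ.toContinuousMonoidHom.comp (absGaloisRestrict ℚ K)))
  (W : WeierstrassCurve ℚ) [W.IsElliptic] [ContinuousSMul ℤ_[p] (W.tateModule p)]
  [ContinuousSMul ℤ_[p] ((W.baseChange K).tateModule p)]
  (A' : WeierstrassCurve ℚ) [A'.IsElliptic] [ContinuousSMul ℤ_[p] (A'.tateModule p)]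
  (u : A'.tateModule p ≃ₗ[ℤ_[p]] W.tateModule p) (hu : Continuous u) (hu' : Continuous u.symm)
  (hu₁ : ∀ σ : absoluteGaloisGroup ℚ, σ ∈ galRange (K := ℚ) K → ∀ x : A'.tateModule p, u (σ • x) = σ • u x)

/-- **The twisted restriction at the `n`-th layer** `res^A_n : H¹(ℚ_n, T_pA) → H¹(K_n, T_pW_K)`: restrict to the model `V_n`, change
coefficients along `u`, identify `H¹(V_n, T_pW)` with `H¹(K_n, T_pW_K)`. [cite: NeukirchSchmidtWingberg2008, I §5 Prop. 1.5.4] -/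
def layerResTwist (n : ℕ) :
    H1 (tateRep A' p) (κ.layerSubgroup n) →ₗ[ℤ_[p]] H1 (tateRepK (W.baseChange K) p) ((κ.restrict K h).layerSubgroup n) :=
  (layerOfGalRange K κ h W n).hom.toLinearMap ∘ₗ (layerTwist K κ W A' u hu hu₁ n).hom.toLinearMap ∘ₗ
    (resLe (tateRep A' p).toTopRep (layerGalRange_le K κ n) 1).hom.toLinearMap

/-- Unfolding `layerResTwist`. [cite: NeukirchSchmidtWingberg2008, I §5 Prop. 1.5.4] -/
theorem layerResTwist_apply (n : ℕ) (y : H1 (tateRep A' p) (κ.layerSubgroup n)) :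
    layerResTwist K κ h W A' u hu hu₁ n y =
      layerOfGalRange K κ h W n (layerTwist K κ W A' u hu hu₁ n (resLe (tateRep A' p).toTopRep (layerGalRange_le K κ n) 1 y)) := rfl

/-- **`res^A_n` maps integral classes to integral classes.** [cite: Kato2004Asterisque, §8.2 and Lemma 8.5 (pp. 180–184)] -/
theorem layerResTwist_mem_integralH1K (n : ℕ) {y : H1 (tateRep A' p) (κ.layerSubgroup n)}
    (hy : y ∈ integralH1 (tateRep A' p) p (κ.layerSubgroup n)) :
    layerResTwist K κ h W A' u hu hu₁ n y ∈ integralH1K (tateRepK (W.baseChange K) p) p ((κ.restrict K h).layerSubgroup n) := by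
  rw [layerResTwist_apply]
  exact layerOfGalRange_mem_integralH1K K κ h W n
    (layerTwist_mem_integralH1 K κ W A' u hu hu₁ n (resLe_mem_integralH1 _ p _ hy))

/-- **`res^A` commutes with the trace maps**: `res^A_n ∘ Cor_{ℚ_{n+1}/ℚ_n} = Cor_{K_{n+1}/K_n} ∘ res^A_{n+1}`. [cite: NeukirchSchmidtWingberg2008, I §5 (1.5.6)] -/
theorem layerResTwist_layerCores (n : ℕ) (y : H1 (tateRep A' p) (κ.layerSubgroup (n + 1))) :
    layerResTwist K κ h W A' u hu hu₁ n (layerCores (tateRep A' p) κ n y) =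
      layerCoresOver (tateRepK (W.baseChange K) p) (κ.restrict K h) n (layerResTwist K κ h W A' u hu hu₁ (n + 1) y) := by
  haveI := finiteIndex_layerGalRange K κ (n + 1)
  letI : Fintype (layerGalRange K κ n ⧸ (layerGalRange K κ (n + 1)).subgroupOf (layerGalRange K κ n)) := Fintype.ofFinite _
  rw [layerResTwist_apply, layerResTwist_apply, resLe_layerCores_eq_coresLe_resLe K κ h A' n, layerTwist_coresLe,
    layerOfGalRange_coresLe]

/-- **`res^A_n` is equivariant** (for `K/ℚ` Galois): `res^A_n (res g · y) = g · res^A_n y`, `g ∈ Γ_K`. [cite: NeukirchSchmidtWingberg2008, I §5 Prop. 1.5.4] -/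
theorem layerResTwist_conjMap [(galRange (K := ℚ) K).Normal] (n : ℕ) (g : absoluteGaloisGroup K)
    (y : H1 (tateRep A' p) (κ.layerSubgroup n)) :
    layerResTwist K κ h W A' u hu hu₁ n (conjMap (tateRep A' p).toTopRep (κ.layerSubgroup n) (absGaloisRestrict ℚ K g) 1 y) =
      conjMap (tateRepK (W.baseChange K) p).toTopRep ((κ.restrict K h).layerSubgroup n) g 1 (layerResTwist K κ h W A' u hu hu₁ n y) := by
  haveI := normal_layerGalRange K κ n
  rw [layerResTwist_apply, layerResTwist_apply, resLe_conjMap,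
    layerTwist_conjMap K κ W A' u hu hu₁ n (g := absGaloisRestrict ℚ K g) ⟨g, rfl⟩, layerOfGalRange_conjMap]

/-- **The twisted corestriction at the `n`-th layer** `cor^A_n : H¹(K_n, T_pW_K) → H¹(ℚ_n, T_pA)`: model, change coefficients along `u⁻¹`,
`cor_{U_n/V_n}`. [cite: NeukirchSchmidtWingberg2008, I §5 (1.5.6)–(1.5.7)] -/
def layerCorTwist (n : ℕ) :
    H1 (tateRepK (W.baseChange K) p) ((κ.restrict K h).layerSubgroup n) →ₗ[ℤ_[p]] H1 (tateRep A' p) (κ.layerSubgroup n) :=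
  haveI := finite_quotient_layerGalRange K κ n
  haveI : Fintype (κ.layerSubgroup n ⧸ (layerGalRange K κ n).subgroupOf (κ.layerSubgroup n)) := Fintype.ofFinite _
  (coresLe (tateRep A' p).toTopRep (layerGalRange_le K κ n) (isOpen_layerGalRange K κ n)).comp
    ((layerUntwist K κ W A' u hu' hu₁ n).hom.toLinearMap ∘ₗ (layerToGalRange K κ h W n).hom.toLinearMap)

/-- `cor^A_n = cor_{U_n/V_n} ∘ u⁻¹_* ∘ layerToGalRange n` for ANY finiteness structure on `U_n ⧸ V_n`. [cite: NeukirchSchmidtWingberg2008, I §5 (1.5.6)] -/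
theorem layerCorTwist_apply (n : ℕ) [inst : Fintype (κ.layerSubgroup n ⧸ (layerGalRange K κ n).subgroupOf (κ.layerSubgroup n))]
    (y : H1 (tateRepK (W.baseChange K) p) ((κ.restrict K h).layerSubgroup n)) :
    layerCorTwist K κ h W A' u hu' hu₁ n y =
      coresLe (tateRep A' p).toTopRep (layerGalRange_le K κ n) (isOpen_layerGalRange K κ n)
        (layerUntwist K κ W A' u hu' hu₁ n (layerToGalRange K κ h W n y)) := by
  haveI := finite_quotient_layerGalRange K κ n
  obtain rfl : inst = Fintype.ofFinite _ := Subsingleton.elim _ _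
  rfl

/-- **`cor^A_n` maps integral classes to integral classes** (model integrality, `u⁻¹_*` integrality, the general Mackey lemma
`coresLe_mem_integralH1_of_le`). [cite: Kato2004Asterisque, §8.2 and Lemma 8.5 (pp. 180–184)] [cite: NeukirchSchmidtWingberg2008, I §5 (1.5.7)] -/
theorem layerCorTwist_mem_integralH1 (n : ℕ) {y : H1 (tateRepK (W.baseChange K) p) ((κ.restrict K h).layerSubgroup n)}
    (hy : y ∈ integralH1K (tateRepK (W.baseChange K) p) p ((κ.restrict K h).layerSubgroup n)) :
    layerCorTwist K κ h W A' u hu' hu₁ n y ∈ integralH1 (tateRep A' p) p (κ.layerSubgroup n) := by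
  haveI := finite_quotient_layerGalRange K κ n
  letI : Fintype (κ.layerSubgroup n ⧸ (layerGalRange K κ n).subgroupOf (κ.layerSubgroup n)) := Fintype.ofFinite _
  rw [layerCorTwist_apply]
  exact coresLe_mem_integralH1_of_le _ p _ _
    (layerUntwist_mem_integralH1 K κ W A' u hu' hu₁ n (layerToGalRange_mem_integralH1 K κ h W n hy))

/-- **`cor^A` commutes with the trace maps**: `cor^A_n ∘ Cor_{K_{n+1}/K_n} = Cor_{ℚ_{n+1}/ℚ_n} ∘ cor^A_{n+1}` (both are
`cor_{U_n/V_{n+1}} ∘ u⁻¹_* ∘ M_{n+1}`). [cite: NeukirchSchmidtWingberg2008, I §5 Prop. 1.5.3 (iii), (1.5.6)] -/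
theorem layerCorTwist_layerCoresOver (n : ℕ) (y : H1 (tateRepK (W.baseChange K) p) ((κ.restrict K h).layerSubgroup (n + 1))) :
    layerCorTwist K κ h W A' u hu' hu₁ n (layerCoresOver (tateRepK (W.baseChange K) p) (κ.restrict K h) n y) =
      layerCores (tateRep A' p) κ n (layerCorTwist K κ h W A' u hu' hu₁ (n + 1) y) := by
  haveI := finite_quotient_layerGalRange K κ n
  haveI := finite_quotient_layerGalRange K κ (n + 1)
  haveI := finiteIndex_layerGalRange K κ (n + 1)
  haveI hfi : (κ.layerSubgroup (n + 1)).FiniteIndex := finiteIndex_of_isOpen_of_compactSpace _ (κ.isOpen_layerSubgroup (n + 1))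
  letI i0 : Fintype (κ.layerSubgroup n ⧸ (layerGalRange K κ n).subgroupOf (κ.layerSubgroup n)) := Fintype.ofFinite _
  letI i1 : Fintype (κ.layerSubgroup (n + 1) ⧸ (layerGalRange K κ (n + 1)).subgroupOf (κ.layerSubgroup (n + 1))) :=
    Fintype.ofFinite _
  letI i2 : Fintype (layerGalRange K κ n ⧸ (layerGalRange K κ (n + 1)).subgroupOf (layerGalRange K κ n)) := Fintype.ofFinite _
  letI i3 : Fintype (κ.layerSubgroup n ⧸ (layerGalRange K κ (n + 1)).subgroupOf (κ.layerSubgroup n)) := Fintype.ofFinite _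
  letI i4 : Fintype (κ.layerSubgroup n ⧸ (κ.layerSubgroup (n + 1)).subgroupOf (κ.layerSubgroup n)) := Fintype.ofFinite _
  rw [layerCorTwist_apply, layerCorTwist_apply, layerToGalRange_layerCoresOver, layerUntwist_coresLe,
    layerCores_eq_coresLe (tateRep A' p) κ n]
  have h1 := LinearMap.congr_fun (coresLe_comp (tateRep A' p).toTopRep (layerGalRange_antitone K κ n) (layerGalRange_le K κ n)
    (isOpen_layerGalRange K κ (n + 1)) (isOpen_layerGalRange K κ n))
    (layerUntwist K κ W A' u hu' hu₁ (n + 1) (layerToGalRange K κ h W (n + 1) y))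
  have h2 := LinearMap.congr_fun (coresLe_comp (tateRep A' p).toTopRep (layerGalRange_le K κ (n + 1))
    (κ.layerSubgroup_antitone (Nat.le_succ n)) (isOpen_layerGalRange K κ (n + 1)) (κ.isOpen_layerSubgroup (n + 1)))
    (layerUntwist K κ W A' u hu' hu₁ (n + 1) (layerToGalRange K κ h W (n + 1) y))
  rw [LinearMap.comp_apply] at h1 h2
  rw [h1, h2]

/-- **`cor^A_n` is equivariant** (for `K/ℚ` Galois): `cor^A_n (g · y) = res g · cor^A_n y`, `g ∈ Γ_K`. [cite: NeukirchSchmidtWingberg2008, I §5 Prop. 1.5.4] -/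
theorem layerCorTwist_conjMap [(galRange (K := ℚ) K).Normal] (n : ℕ) (g : absoluteGaloisGroup K)
    (y : H1 (tateRepK (W.baseChange K) p) ((κ.restrict K h).layerSubgroup n)) :
    layerCorTwist K κ h W A' u hu' hu₁ n (conjMap (tateRepK (W.baseChange K) p).toTopRep ((κ.restrict K h).layerSubgroup n) g 1 y) =
      conjMap (tateRep A' p).toTopRep (κ.layerSubgroup n) (absGaloisRestrict ℚ K g) 1 (layerCorTwist K κ h W A' u hu' hu₁ n y) := by
  haveI := normal_layerGalRange K κ n
  haveI := finite_quotient_layerGalRange K κ n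
  letI : Fintype (κ.layerSubgroup n ⧸ (layerGalRange K κ n).subgroupOf (κ.layerSubgroup n)) := Fintype.ofFinite _
  rw [layerCorTwist_apply, layerCorTwist_apply, layerToGalRange_conjMap, layerUntwist_conjMap K κ W A' u hu' hu₁ n (g := absGaloisRestrict ℚ K g) ⟨g, rfl⟩]
  exact coresLe_conjMap (tateRep A' p).toTopRep (layerGalRange_le K κ n) (isOpen_layerGalRange K κ n) _ _

end Layer

/-! ## §2 The twisted maps on the pinned carriers -/

section Carriers

variable {K : Type} [Field K] [NumberField K] {p : ℕ} [Fact p.Prime] {κ : ZpExtension ℚ p}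
  {h : Function.Surjective (κ.toContinuousMonoidHom.comp (absGaloisRestrict ℚ K))}
  {W : WeierstrassCurve ℚ} [W.IsElliptic] [ContinuousSMul ℤ_[p] (W.tateModule p)]
  [ContinuousSMul ℤ_[p] ((W.baseChange K).tateModule p)]
  {A' : WeierstrassCurve ℚ} [A'.IsElliptic] [ContinuousSMul ℤ_[p] (A'.tateModule p)]
  (u : A'.tateModule p ≃ₗ[ℤ_[p]] W.tateModule p) (hu : Continuous u) (hu' : Continuous u.symm)
  (hu₁ : ∀ σ : absoluteGaloisGroup ℚ, σ ∈ galRange (K := ℚ) K → ∀ x : A'.tateModule p, u (σ • x) = σ • u x)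
  {γ : absoluteGaloisGroup ℚ} {γK : absoluteGaloisGroup K}
  (I_A : IwasawaH1Data A' p κ γ) (IK : IwasawaH1DataOver (W.baseChange K) p (κ.restrict K h) γK)

/-- A linear map intertwining two endomorphisms intertwines the polynomials in them. [folklore] -/
private theorem map_aeval_apply_of_comp_eq_twist {N₁ N₂ : Type*} [AddCommGroup N₁] [Module ℤ_[p] N₁]
    [AddCommGroup N₂] [Module ℤ_[p] N₂] (g : N₁ →ₗ[ℤ_[p]] N₂) (a : Module.End ℤ_[p] N₁) (b : Module.End ℤ_[p] N₂)
    (hg : g ∘ₗ a = b ∘ₗ g) (r : ℤ_[p][X]) (m : N₁) : g (aeval a r m) = aeval b r (g m) := by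
  induction r using Polynomial.induction_on generalizing m with
  | C c => simp
  | add f₁ f₂ h₁ h₂ => simp [h₁, h₂]
  | monomial k c hk =>
    have hc : ∀ m, g (a m) = b (g m) := fun m => by simpa using LinearMap.congr_fun hg m
    rw [pow_succ, ← mul_assoc]
    conv_rhs => rw [map_mul, Module.End.mul_apply, aeval_X]
    conv_lhs => rw [map_mul, Module.End.mul_apply, aeval_X]
    rw [hk, hc]

namespace IwasawaH1Data

/-- The levelwise twisted restrictions `(res^A_n (proj n x))_n` of `x ∈ 𝐇¹_Γ(T_pA)`. [cite: NeukirchSchmidtWingberg2008, I §5] -/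
def resTwistFamily (x : I_A.H) : ∀ n : ℕ, H1 (tateRepK (W.baseChange K) p) ((κ.restrict K h).layerSubgroup n) :=
  fun n ↦ layerResTwist K κ h W A' u hu hu₁ n (I_A.proj n x)

/-- Unfolding `resTwistFamily`. [cite: NeukirchSchmidtWingberg2008, I §5 Prop. 1.5.4] -/
@[simp] theorem resTwistFamily_apply (x : I_A.H) (n : ℕ) :
    I_A.resTwistFamily (h := h) u hu hu₁ x n = layerResTwist K κ h W A' u hu hu₁ n (I_A.proj n x) := rfl

/-- The levelwise twisted restrictions form a norm-compatible INTEGRAL family over `K`. [cite: Kato2004Asterisque, §12.2 (p. 220)] -/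
theorem isNormCompatibleOver_resTwistFamily (x : I_A.H) :
    IsNormCompatibleOver (tateRepK (W.baseChange K) p) (κ.restrict K h) (I_A.resTwistFamily (h := h) u hu hu₁ x) :=
  ⟨fun n ↦ layerResTwist_mem_integralH1K K κ h W A' u hu hu₁ n (I_A.proj_mem n x),
    fun n ↦ by rw [resTwistFamily_apply, resTwistFamily_apply, ← layerResTwist_layerCores, I_A.cores_proj]⟩

/-- `res^A_n` intertwines the level operators (for `K/ℚ` Galois): `res^A_n ∘ (conj_γ − 1) = (conj_{γK} − 1) ∘ res^A_n`
(`conj_γ = conj_{res γK}` on `H¹(ℚ_n, T_pA)`). [cite: NeukirchSchmidtWingberg2008, I §5 Prop. 1.5.4] -/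
theorem layerResTwist_comp_conj_sub_one [(galRange (K := ℚ) K).Normal] (hγ : κ.IsTopGenerator γ)
    (hγK : (κ.restrict K h).IsTopGenerator γK) (n : ℕ) :
    (layerResTwist K κ h W A' u hu hu₁ n) ∘ₗ ((conjMap (tateRep A' p).toTopRep (κ.layerSubgroup n) γ 1).hom.toLinearMap - 1) =
      ((conjMap (tateRepK (W.baseChange K) p).toTopRep ((κ.restrict K h).layerSubgroup n) γK 1).hom.toLinearMap - 1) ∘ₗ
        (layerResTwist K κ h W A' u hu hu₁ n) := by
  refine LinearMap.ext fun y ↦ ?_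
  simp only [LinearMap.coe_comp, Function.comp_apply, LinearMap.sub_apply, Module.End.one_apply, map_sub]
  change layerResTwist K κ h W A' u hu hu₁ n (conjMap (tateRep A' p).toTopRep (κ.layerSubgroup n) γ 1 y) - _ =
    conjMap (tateRepK (W.baseChange K) p).toTopRep ((κ.restrict K h).layerSubgroup n) γK 1 (layerResTwist K κ h W A' u hu hu₁ n y) - _
  rw [conjMap_apply_one_eq_of_inv_mul_mem (tateRep A' p).toTopRep (κ.layerSubgroup n)
      (inv_mul_mem_layerSubgroup_of_isTopGenerator_restrict hγ hγK n), layerResTwist_conjMap]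

/-- **The twisted Shapiro restriction `res^A : 𝐇¹_Γ(T_pA) → 𝐇¹_{K,Γ}(T_pW_K)`** on the pinned carriers (for `K/ℚ` Galois): the unique map with
`IK.proj n (res^A x) = res^A_n (I_A.proj n x)`; `Λ`-linear (levelwise actions through `Λ/(ω_n)`, `res^A_n` intertwines the level operators).
[cite: NeukirchSchmidtWingberg2008, I §5 (1.5.6)–(1.5.7)] [cite: Rubin2000, App. B §3] -/
def resOverTwist [(galRange (K := ℚ) K).Normal] (hγ : κ.IsTopGenerator γ) (hγK : (κ.restrict K h).IsTopGenerator γK) :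
    I_A.H →ₗ[IwasawaAlgebra p] IK.H where
  toFun x := (IK.proj_surjective _ (I_A.isNormCompatibleOver_resTwistFamily (h := h) u hu hu₁ x)).choose
  map_add' x x' := IK.proj_eq_iff.mp fun n ↦ by
    rw [map_add, (IK.proj_surjective _ (I_A.isNormCompatibleOver_resTwistFamily (h := h) u hu hu₁ (x + x'))).choose_spec,
      (IK.proj_surjective _ (I_A.isNormCompatibleOver_resTwistFamily (h := h) u hu hu₁ x)).choose_spec,
      (IK.proj_surjective _ (I_A.isNormCompatibleOver_resTwistFamily (h := h) u hu hu₁ x')).choose_spec,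
      resTwistFamily_apply, resTwistFamily_apply, resTwistFamily_apply, map_add, map_add]
  map_smul' f x := IK.proj_eq_iff.mp fun n ↦ by
    obtain ⟨r, hr⟩ := IwasawaH1Exists.exists_polynomial_sub_coe_mem_span p n f
    rw [RingHom.id_apply,
      (IK.proj_surjective _ (I_A.isNormCompatibleOver_resTwistFamily (h := h) u hu hu₁ (f • x))).choose_spec,
      IK.proj_smul hγK n hr,
      (IK.proj_surjective _ (I_A.isNormCompatibleOver_resTwistFamily (h := h) u hu hu₁ x)).choose_spec,
      resTwistFamily_apply, resTwistFamily_apply, I_A.proj_smul hγ n hr]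
    exact map_aeval_apply_of_comp_eq_twist (layerResTwist K κ h W A' u hu hu₁ n) _ _
      (layerResTwist_comp_conj_sub_one u hu hu₁ hγ hγK n) r (I_A.proj n x)

/-- **The defining property of `res^A`**: `IK.proj n (res^A x) = res^A_n (I_A.proj n x)`. [cite: NeukirchSchmidtWingberg2008, I §5] -/
theorem proj_resOverTwist [(galRange (K := ℚ) K).Normal] (hγ : κ.IsTopGenerator γ) (hγK : (κ.restrict K h).IsTopGenerator γK)
    (n : ℕ) (x : I_A.H) :
    IK.proj n (I_A.resOverTwist u hu hu₁ IK hγ hγK x) = layerResTwist K κ h W A' u hu hu₁ n (I_A.proj n x) :=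
  (IK.proj_surjective _ (I_A.isNormCompatibleOver_resTwistFamily (h := h) u hu hu₁ x)).choose_spec n

/-- **Uniqueness of `res^A`**: any map computed levelwise by the `res^A_n` IS `resOverTwist`. [cite: Rubin2000, App. B §2–§3] -/
theorem resOverTwist_unique [(galRange (K := ℚ) K).Normal] (hγ : κ.IsTopGenerator γ) (hγK : (κ.restrict K h).IsTopGenerator γK)
    {f : I_A.H → IK.H} (hf : ∀ (n : ℕ) (x : I_A.H), IK.proj n (f x) = layerResTwist K κ h W A' u hu hu₁ n (I_A.proj n x)) :
    f = I_A.resOverTwist u hu hu₁ IK hγ hγK :=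
  funext fun x ↦ IK.proj_eq_iff.mp fun n ↦ by rw [hf, proj_resOverTwist]

end IwasawaH1Data

namespace IwasawaH1DataOver

/-- The levelwise twisted corestrictions `(cor^A_n (proj n x))_n` of `x ∈ 𝐇¹_{K,Γ}(T_pW_K)`. [cite: NeukirchSchmidtWingberg2008, I §5] -/
def corTwistFamily (x : IK.H) : ∀ n : ℕ, H1 (tateRep A' p) (κ.layerSubgroup n) :=
  fun n ↦ layerCorTwist K κ h W A' u hu' hu₁ n (IK.proj n x)

/-- Unfolding `corTwistFamily`. [cite: NeukirchSchmidtWingberg2008, I §5 (1.5.6)] -/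
@[simp] theorem corTwistFamily_apply (x : IK.H) (n : ℕ) :
    IK.corTwistFamily u hu' hu₁ x n = layerCorTwist K κ h W A' u hu' hu₁ n (IK.proj n x) := rfl

/-- The levelwise twisted corestrictions form a norm-compatible INTEGRAL family over `ℚ`. [cite: Kato2004Asterisque, §12.2 (p. 220)] -/
theorem isNormCompatible_corTwistFamily (x : IK.H) : IsNormCompatible (tateRep A' p) κ (IK.corTwistFamily u hu' hu₁ x) :=
  ⟨fun n ↦ layerCorTwist_mem_integralH1 K κ h W A' u hu' hu₁ n (IK.proj_mem n x),
    fun n ↦ by rw [corTwistFamily_apply, corTwistFamily_apply, ← layerCorTwist_layerCoresOver, IK.cores_proj]⟩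

/-- `cor^A_n` intertwines the level operators (for `K/ℚ` Galois): `cor^A_n ∘ (conj_{γK} − 1) = (conj_γ − 1) ∘ cor^A_n`.
[cite: NeukirchSchmidtWingberg2008, I §5 Prop. 1.5.4] -/
theorem layerCorTwist_comp_conj_sub_one [(galRange (K := ℚ) K).Normal] (hγ : κ.IsTopGenerator γ)
    (hγK : (κ.restrict K h).IsTopGenerator γK) (n : ℕ) :
    (layerCorTwist K κ h W A' u hu' hu₁ n) ∘ₗ
        ((conjMap (tateRepK (W.baseChange K) p).toTopRep ((κ.restrict K h).layerSubgroup n) γK 1).hom.toLinearMap - 1) =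
      ((conjMap (tateRep A' p).toTopRep (κ.layerSubgroup n) γ 1).hom.toLinearMap - 1) ∘ₗ (layerCorTwist K κ h W A' u hu' hu₁ n) := by
  refine LinearMap.ext fun y ↦ ?_
  simp only [LinearMap.coe_comp, Function.comp_apply, LinearMap.sub_apply, Module.End.one_apply, map_sub]
  change layerCorTwist K κ h W A' u hu' hu₁ n
      (conjMap (tateRepK (W.baseChange K) p).toTopRep ((κ.restrict K h).layerSubgroup n) γK 1 y) - _ =
    conjMap (tateRep A' p).toTopRep (κ.layerSubgroup n) γ 1 (layerCorTwist K κ h W A' u hu' hu₁ n y) - _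
  rw [layerCorTwist_conjMap, conjMap_apply_one_eq_of_inv_mul_mem (tateRep A' p).toTopRep (κ.layerSubgroup n)
      (IwasawaH1Data.inv_mul_mem_layerSubgroup_of_isTopGenerator_restrict hγ hγK n)]

/-- **The twisted Shapiro corestriction `cor^A : 𝐇¹_{K,Γ}(T_pW_K) → 𝐇¹_Γ(T_pA)`** on the pinned carriers (for `K/ℚ` Galois): the unique map with
`I_A.proj n (cor^A x) = cor^A_n (IK.proj n x)`; `Λ`-linear. [cite: NeukirchSchmidtWingberg2008, I §5 (1.5.6)–(1.5.7)] [cite: Rubin2000, App. B §3] -/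
def corOverTwist [(galRange (K := ℚ) K).Normal] (hγK : (κ.restrict K h).IsTopGenerator γK) (hγ : κ.IsTopGenerator γ) :
    IK.H →ₗ[IwasawaAlgebra p] I_A.H where
  toFun x := (I_A.proj_surjective _ (IK.isNormCompatible_corTwistFamily u hu' hu₁ x)).choose
  map_add' x x' := I_A.ext_of_proj fun n ↦ by
    rw [map_add, (I_A.proj_surjective _ (IK.isNormCompatible_corTwistFamily u hu' hu₁ (x + x'))).choose_spec,
      (I_A.proj_surjective _ (IK.isNormCompatible_corTwistFamily u hu' hu₁ x)).choose_spec,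
      (I_A.proj_surjective _ (IK.isNormCompatible_corTwistFamily u hu' hu₁ x')).choose_spec,
      corTwistFamily_apply, corTwistFamily_apply, corTwistFamily_apply, map_add, map_add]
  map_smul' f x := I_A.ext_of_proj fun n ↦ by
    obtain ⟨r, hr⟩ := IwasawaH1Exists.exists_polynomial_sub_coe_mem_span p n f
    rw [RingHom.id_apply,
      (I_A.proj_surjective _ (IK.isNormCompatible_corTwistFamily u hu' hu₁ (f • x))).choose_spec,
      I_A.proj_smul hγ n hr,
      (I_A.proj_surjective _ (IK.isNormCompatible_corTwistFamily u hu' hu₁ x)).choose_spec,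
      corTwistFamily_apply, corTwistFamily_apply, IK.proj_smul hγK n hr]
    exact map_aeval_apply_of_comp_eq_twist (layerCorTwist K κ h W A' u hu' hu₁ n) _ _
      (layerCorTwist_comp_conj_sub_one u hu' hu₁ hγ hγK n) r (IK.proj n x)

/-- **The defining property of `cor^A`**: `I_A.proj n (cor^A x) = cor^A_n (IK.proj n x)`. [cite: NeukirchSchmidtWingberg2008, I §5 (1.5.6)] -/
theorem proj_corOverTwist [(galRange (K := ℚ) K).Normal] (hγK : (κ.restrict K h).IsTopGenerator γK) (hγ : κ.IsTopGenerator γ)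
    (n : ℕ) (x : IK.H) :
    I_A.proj n (IK.corOverTwist u hu' hu₁ I_A hγK hγ x) = layerCorTwist K κ h W A' u hu' hu₁ n (IK.proj n x) :=
  (I_A.proj_surjective _ (IK.isNormCompatible_corTwistFamily u hu' hu₁ x)).choose_spec n

/-- **Uniqueness of `cor^A`**: any map computed levelwise by the `cor^A_n` IS `corOverTwist`. [cite: Rubin2000, App. B §2–§3] -/
theorem corOverTwist_unique [(galRange (K := ℚ) K).Normal] (hγK : (κ.restrict K h).IsTopGenerator γK) (hγ : κ.IsTopGenerator γ)
    {f : IK.H → I_A.H} (hf : ∀ (n : ℕ) (x : IK.H), I_A.proj n (f x) = layerCorTwist K κ h W A' u hu' hu₁ n (IK.proj n x)) :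
    f = IK.corOverTwist u hu' hu₁ I_A hγK hγ :=
  funext fun x ↦ I_A.ext_of_proj fun n ↦ by rw [hf, proj_corOverTwist]

end IwasawaH1DataOver

end Carriers

end Literature.NumberTheory.EllipticCurves.Kato2004

end
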